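import Summits.QuantumFields.YangMills.Theorems.ColdStartUniversalityLatticeLangevinCocycleMain
import Summits.QuantumFields.YangMills.Theorems.ColdStartUniversalityLatticeLangevinLocalSmall
import HarnessLib

/-!
# Route `ColdStartUniversality` (crux K_A1 stmt-QuantumFields-24809): the rung `stub_fixedCutoffMixing` from the two
# textbook forms of the Doeblin input

Helper file (seat `ym-line-csu-p1`, g4).  With Chapman–Kolmogorov for THE SZZ transition kernels proved in this tree
(`chapmanKolmogorov_szz`) and the Feller property (`continuous_integral_transitionKernel`), the only analytic input
(D) of `fixedCutoffMixing_of_doeblin` is supplied in either of its two textbook forms: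

* `fixedCutoffMixing_of_localSmall` — (D) ⇐ a LOCAL minorisation near one configuration + pointed irreducibility
  (`doeblin_of_localSmall`, tree small-set theory, Cuneo–Eckmann–Hairer–Rey-Bellet Prop. 3.6);
* `fixedCutoffMixing_of_positiveDensity` — (D) ⇐ a jointly continuous, strictly positive transition density at ONE
  time with respect to a non-zero reference measure (`doeblin_of_continuous_pos_density`, compactness of `SU(2)^E`);
  this is the form delivered by elliptic regularity (Hörmander / heat-kernel positivity) for the link diffusion.

Both remain CONDITIONAL on the named fact `WilsonMeasureLangevinInvariant` (SZZ Lemma 3.3).  No definition, no sorry.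
RECORD-rung R3 plumbing; nothing here bears on the mass gap.
-/

set_option autoImplicit false

noncomputable section

namespace Summit.QuantumFields.YangMills.Theorems.ColdStartUniversality

open MeasureTheory ProbabilityTheory Filter Topology
open scoped NNReal ENNReal BigOperators
open Literature.Probability.Process Literature.MathematicalPhysics.QuantumFieldTheory
open Literature.MathematicalPhysics.QuantumLattice (fundamentalRep fundamentalLatticeRep)

/-- **Doeblin from a continuous positive density on a compact space**: if `κ z = λ.withDensity (p z ·)` with
`(z, y) ↦ p z y` continuous and strictly positive on the compact `X × X` and `λ ≠ 0`, then `ν ≤ κ z` for all `z` with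
the non-zero measure `ν = (min p) • λ`. [folklore] -/
theorem doeblin_of_continuous_pos_density {X : Type*} [TopologicalSpace X] [CompactSpace X] [Nonempty X]
    [MeasurableSpace X] (κ : Kernel X X) {la : Measure X} (hla : la ≠ 0) {p : X → X → ℝ≥0}
    (hp : Continuous (Function.uncurry p)) (hpos : ∀ z y, 0 < p z y)
    (hκ : ∀ z, κ z = la.withDensity fun y => (p z y : ℝ≥0∞)) :
    ∃ ν : Measure X, ν ≠ 0 ∧ ∀ z, ν ≤ κ z := by
  obtain ⟨q₀, -, hq₀⟩ := isCompact_univ.exists_isMinOn Set.univ_nonempty hp.continuousOn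
  have hc : 0 < p q₀.1 q₀.2 := hpos _ _
  have hmin : ∀ z y, p q₀.1 q₀.2 ≤ p z y := fun z y => hq₀ (Set.mem_univ (z, y))
  refine ⟨(p q₀.1 q₀.2 : ℝ≥0∞) • la, fun h => ?_, fun z => ?_⟩
  · have h1 : ((p q₀.1 q₀.2 : ℝ≥0∞) • la) Set.univ = 0 := by rw [h]; rfl
    rw [Measure.smul_apply, smul_eq_mul] at h1
    rcases mul_eq_zero.1 h1 with h3 | h3
    · exact hc.ne' (by exact_mod_cast h3)
    · exact hla (Measure.measure_univ_eq_zero.1 h3)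
  · rw [hκ z]
    refine Measure.le_iff.2 fun A hA => ?_
    rw [Measure.smul_apply, withDensity_apply _ hA, smul_eq_mul, ← setLIntegral_const]
    exact setLIntegral_mono' hA fun y _ => by exact_mod_cast hmin z y

/-- **The rung `stub_fixedCutoffMixing` from a local small set + pointed irreducibility** for THE SZZ kernels (and the
named fact `WilsonMeasureLangevinInvariant`): Chapman–Kolmogorov (`chapmanKolmogorov_szz`), Feller, the tree's
small-set theorem and Harris' theorem. [cite: CuneoEckmannHairerReyBellet2018, Prop 3.6]
[cite: HairerMattingly2011, Theorems 1.2 and 1.3] -/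
theorem fixedCutoffMixing_of_localSmall
    (hLS : ∀ (L : ℕ) [NeZero L] (β' : ℝ)
      (κ : ℝ≥0 → Kernel (GaugeConfig 3 L (Matrix.specialUnitaryGroup (Fin 2) ℂ))
        (GaugeConfig 3 L (Matrix.specialUnitaryGroup (Fin 2) ℂ))) [∀ t, IsMarkovKernel (κ t)],
      (∀ (t : ℝ≥0) (x : GaugeConfig 3 L (Matrix.specialUnitaryGroup (Fin 2) ℂ))
          (Ω : Type) [MeasurableSpace Ω] (P : Measure Ω) [IsProbabilityMeasure P]
          (W : ℝ≥0 → Ω → (Edge 3 L × NoiseIdx 2 → ℝ)) (hW : IsFlatBrownian W P)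
          (U : ℝ≥0 → Ω → GaugeConfig 3 L (Matrix.specialUnitaryGroup (Fin 2) ℂ)),
          (∀ ω, U 0 ω = x) →
          (latticeLangevinDynamics (fundamentalLatticeRep 2) β').IsSolution (fundamentalRep (Fin 2))
            hW.natFiltration P W U →
          κ t x = P.map (U t)) →
      ∃ (x₀ : GaugeConfig 3 L (Matrix.specialUnitaryGroup (Fin 2) ℂ))
        (G₀ : Set (GaugeConfig 3 L (Matrix.specialUnitaryGroup (Fin 2) ℂ)))
        (ν₀ : Measure (GaugeConfig 3 L (Matrix.specialUnitaryGroup (Fin 2) ℂ)))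
        (y₀ : GaugeConfig 3 L (Matrix.specialUnitaryGroup (Fin 2) ℂ)) (t₀ δ : ℝ),
        (∀ (z : GaugeConfig 3 L (Matrix.specialUnitaryGroup (Fin 2) ℂ))
            (V : Set (GaugeConfig 3 L (Matrix.specialUnitaryGroup (Fin 2) ℂ))),
            IsOpen V → x₀ ∈ V → ∃ t : ℝ≥0, 0 < κ t z V) ∧
        IsOpen G₀ ∧ x₀ ∈ G₀ ∧
        (∀ V : Set (GaugeConfig 3 L (Matrix.specialUnitaryGroup (Fin 2) ℂ)), IsOpen V → y₀ ∈ V → 0 < ν₀ V) ∧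
        0 < δ ∧ δ ≤ t₀ ∧
        (∀ t : ℝ≥0, t₀ - δ ≤ (t : ℝ) → (t : ℝ) ≤ t₀ + δ → ∀ w ∈ G₀, ν₀ ≤ κ t w))
    (hWinv : ∀ (L : ℕ) [NeZero L] (β' : ℝ), WilsonMeasureLangevinInvariant (fundamentalLatticeRep 2) 3 L β') :
    ∀ (F : Balaban1983to89.T3ContinuumYM3Torus.T3Family) (γ : ℝ), 0 < γ →
      ∀ (os : List (Balaban1983to89.T3ContinuumYM3Torus.ULoop3 F)) (δ : ℝ), 0 < δ → ∀ K : ℕ, ∃ T : ℝ, 0 < T ∧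
        ∀ (Ω : Type) (mΩ : MeasurableSpace Ω) (P : Measure Ω) (hP : IsProbabilityMeasure P)
          (W : ℝ≥0 → Ω → (Edge 3 ((F.P K).sitesPerDir 0) × NoiseIdx 2 → ℝ)) (hW : IsFlatBrownian W P)
          (U : ℝ≥0 → Ω → GaugeConfig 3 ((F.P K).sitesPerDir 0) (Matrix.specialUnitaryGroup (Fin 2) ℂ)),
          (∀ ω, U 0 ω = fun _ => 1) →
          (latticeLangevinDynamics (fundamentalLatticeRep 2) ((γ * (F.P K).eps)⁻¹ / 2)).IsSolution
            (fundamentalRep (Fin 2)) hW.natFiltration P W U →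
          |(F.scheme (Balaban1983to89.ExpMeanLog.expMeanLogSU :
                Balaban1983to89.LoopAverage (Matrix.specialUnitaryGroup (Fin 2) ℂ)) γ).expectAt K os -
              T⁻¹ * ∫ s in (0 : ℝ)..T, (∫ ω, (os.map fun C => F.avgObs (Balaban1983to89.ExpMeanLog.expMeanLogSU :
                  Balaban1983to89.LoopAverage (Matrix.specialUnitaryGroup (Fin 2) ℂ)) K C
                (fun b : Balaban1983to89.PBond (F.P K) 0 => U (s / (F.P K).eps).toNNReal ω (b.src, b.dir))).prod ∂P)| ≤ δ :=
  fixedCutoffMixing_of_doeblin (fun L _ β' κ _ hreal => by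
    obtain ⟨x₀, G₀, ν₀, y₀, t₀, δ, hirr, hG₀, hx₀, hy₀, hδ, hδt, hloc⟩ := hLS L β' κ hreal
    exact doeblin_of_localSmall L β' κ hreal (chapmanKolmogorov_szz β' κ hreal) hirr hG₀ hx₀ hy₀ hδ hδt hloc) hWinv

/-- **The rung `stub_fixedCutoffMixing` from a continuous positive transition density at one time** for THE SZZ
kernels (and the named fact `WilsonMeasureLangevinInvariant`): compactness of `SU(2)^E`
(`doeblin_of_continuous_pos_density`), Chapman–Kolmogorov and Harris' theorem (`fixedCutoffMixing_of_doeblin`).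
[cite: HairerMattingly2011, Theorems 1.2 and 1.3] -/
theorem fixedCutoffMixing_of_positiveDensity
    (hDens : ∀ (L : ℕ) [NeZero L] (β' : ℝ)
      (κ : ℝ≥0 → Kernel (GaugeConfig 3 L (Matrix.specialUnitaryGroup (Fin 2) ℂ))
        (GaugeConfig 3 L (Matrix.specialUnitaryGroup (Fin 2) ℂ))) [∀ t, IsMarkovKernel (κ t)],
      (∀ (t : ℝ≥0) (x : GaugeConfig 3 L (Matrix.specialUnitaryGroup (Fin 2) ℂ))
          (Ω : Type) [MeasurableSpace Ω] (P : Measure Ω) [IsProbabilityMeasure P]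
          (W : ℝ≥0 → Ω → (Edge 3 L × NoiseIdx 2 → ℝ)) (hW : IsFlatBrownian W P)
          (U : ℝ≥0 → Ω → GaugeConfig 3 L (Matrix.specialUnitaryGroup (Fin 2) ℂ)),
          (∀ ω, U 0 ω = x) →
          (latticeLangevinDynamics (fundamentalLatticeRep 2) β').IsSolution (fundamentalRep (Fin 2))
            hW.natFiltration P W U →
          κ t x = P.map (U t)) →
      ∃ (t₀ : ℝ≥0) (la : Measure (GaugeConfig 3 L (Matrix.specialUnitaryGroup (Fin 2) ℂ)))
        (p : GaugeConfig 3 L (Matrix.specialUnitaryGroup (Fin 2) ℂ) →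
          GaugeConfig 3 L (Matrix.specialUnitaryGroup (Fin 2) ℂ) → ℝ≥0),
        la ≠ 0 ∧ Continuous (Function.uncurry p) ∧ (∀ z y, 0 < p z y) ∧
        ∀ z, κ t₀ z = la.withDensity fun y => (p z y : ℝ≥0∞))
    (hWinv : ∀ (L : ℕ) [NeZero L] (β' : ℝ), WilsonMeasureLangevinInvariant (fundamentalLatticeRep 2) 3 L β') :
    ∀ (F : Balaban1983to89.T3ContinuumYM3Torus.T3Family) (γ : ℝ), 0 < γ →
      ∀ (os : List (Balaban1983to89.T3ContinuumYM3Torus.ULoop3 F)) (δ : ℝ), 0 < δ → ∀ K : ℕ, ∃ T : ℝ, 0 < T ∧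
        ∀ (Ω : Type) (mΩ : MeasurableSpace Ω) (P : Measure Ω) (hP : IsProbabilityMeasure P)
          (W : ℝ≥0 → Ω → (Edge 3 ((F.P K).sitesPerDir 0) × NoiseIdx 2 → ℝ)) (hW : IsFlatBrownian W P)
          (U : ℝ≥0 → Ω → GaugeConfig 3 ((F.P K).sitesPerDir 0) (Matrix.specialUnitaryGroup (Fin 2) ℂ)),
          (∀ ω, U 0 ω = fun _ => 1) →
          (latticeLangevinDynamics (fundamentalLatticeRep 2) ((γ * (F.P K).eps)⁻¹ / 2)).IsSolution
            (fundamentalRep (Fin 2)) hW.natFiltration P W U →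
          |(F.scheme (Balaban1983to89.ExpMeanLog.expMeanLogSU :
                Balaban1983to89.LoopAverage (Matrix.specialUnitaryGroup (Fin 2) ℂ)) γ).expectAt K os -
              T⁻¹ * ∫ s in (0 : ℝ)..T, (∫ ω, (os.map fun C => F.avgObs (Balaban1983to89.ExpMeanLog.expMeanLogSU :
                  Balaban1983to89.LoopAverage (Matrix.specialUnitaryGroup (Fin 2) ℂ)) K C
                (fun b : Balaban1983to89.PBond (F.P K) 0 => U (s / (F.P K).eps).toNNReal ω (b.src, b.dir))).prod ∂P)| ≤ δ :=
  fixedCutoffMixing_of_doeblin (fun L _ β' κ _ hreal => by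
    obtain ⟨t₀, la, p, hla, hp, hpos, hκ⟩ := hDens L β' κ hreal
    haveI : Nonempty (GaugeConfig 3 L (Matrix.specialUnitaryGroup (Fin 2) ℂ)) := ⟨fun _ => 1⟩
    obtain ⟨ν, hν, hle⟩ := doeblin_of_continuous_pos_density (κ t₀) hla hp hpos hκ
    exact ⟨t₀, ν, hν, hle⟩) hWinv

end Summit.QuantumFields.YangMills.Theorems.ColdStartUniversality

end
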